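import Summits.Ventures.HSemireg.WedgeHankelRecurrenceGaussSymmetricJacobi

/-!
# Venture HSemireg — **THE HOFFMAN–WIELANDT INEQUALITY FOR TWO POSITIVE RECURRENCES**: if `x_0 < ⋯ < x_t` are the zeros of `q_{t+1}` (data `a, b > 0`) and `y_0 < ⋯ < y_t` those of `q'_{t+1}`
# (data `a', b' > 0`), then **`Σ_k (y_k − x_k)² ≤ Σ_{i≤t} (a'_i − a_i)² + 2 Σ_{i<t} (√b'_{i+1} − √b_{i+1})²`** (`= ‖J'^s − J^s‖_F²` for the symmetric Jacobi matrices); on the way,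
# **`tr(J^s J'^s) ≤ Σ_k x_k y_k`** and **`Σ_k x_k² = Σ_i a_i² + 2 Σ_{i<t} b_{i+1} = tr((J^s)²)`**

HONEST FRAMING. Part of the Lean index of the computation cell `pub-hsemireg` (seat p10 gen 47, Sunday typer «UNIFORM-IN-n»).  Real square matrices, `Real.sqrt` and finite sums only; no variety, no
cohomology theory, no sheaf, no Ext group and no semiregularity map is constructed here; nothing here says that HC / HC_CM / HC_AV holds; no Literature fact (unproved `Prop`) is declared or used.
Custodian versions as in `WedgeHankelSiegelIdeal` (1/3).
SOURCES (cited).  A. J. Hoffman, H. W. Wielandt, *The variation of the spectrum of a normal matrix*, Duke Math. J. 20 (1953) 37–39, Thm 1; R. Bhatia, *Matrix Analysis* (1997), Thm VI.4.1;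
J. H. Wilkinson, *The Algebraic Eigenvalue Problem* (1965), Ch. 2 §48 (the real symmetric case); G. H. Golub, C. F. Van Loan, *Matrix Computations* (4th ed.), Thm 8.1.4; for Jacobi matrices:
W. Gautschi, *Orthogonal Polynomials* (2004), §3.1 (sensitivity of Gauss nodes to the recurrence coefficients).
PROOF TYPED HERE.  N416: `tr(J^s J'^s) = Σ_{k,l} (QᵀQ')_{kl}² x_k y_l` with `QᵀQ'` orthogonal, so N415 `sum_sq_mul_mul_le_of_orthogonal` gives `tr(J^s J'^s) ≤ Σ x_k y_k`; with `Q' = Q` the same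
identity gives `Σ x_k² = tr((J^s)²)`; N416 `trace_symmJacobi_mul` evaluates the three traces entrywise; the inequality is `2(Σ x_k y_k − tr(J^s J'^s)) ≥ 0` rearranged.
DEDUP DISCLOSURE (`rg -n -i 'hoffman|wielandt|frobenius' Summits/Ventures/HSemireg Literature`, 2026-09-04): N387 (`ℓ¹`, equal couplings), N324 ∕ N354 (`ℓ^∞`); the `ℓ²` ∕ Frobenius bound with
different couplings is new; 0 hits for the 3 names below.

WHAT IS IN THE TREE.  N415 `sum_sq_mul_mul_le_of_orthogonal`; N416 `symmJacobi_orthogonal_eigen`, `trace_symmJacobi_mul_eq_sum_sq`, `trace_symmJacobi_mul`; N298 `sum_recurrence_zeros_sq` (not used: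
the second Newton sum is re-derived from the trace).
THIS FILE (namespace `Summit.Ventures.HSemireg.Wedge.HankelOuter` continued; CHAINED on N416; 0 definitions):
* §1182 **`trace_symmJacobi_mul_le`** (`Σ_i a_i a'_i + 2 Σ √b_{i+1} √b'_{i+1} ≤ Σ_k x_k y_k`), `zeros_sq_sum_eq_trace` (`Σ_k x_k² = Σ_i a_i² + 2 Σ_{i<t} b_{i+1}`), **`hoffman_wielandt_recurrence`**.
CAVEATS.  Both recurrences positive (`b, b' > 0`) and of the same size; zeros increasing.  Nothing Ext-side.  New names only.
-/

open Module Polynomial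
open scoped Matrix Polynomial

namespace Summit.Ventures.HSemireg.Wedge.HankelOuter

/-! ## §1182. Hoffman–Wielandt for Jacobi matrices -/

/-- **`tr(J^s J'^s) ≤ Σ_k x_k y_k`, i.e. `Σ_{i≤t} a_i a'_i + 2 Σ_{i<t} √b_{i+1} √b'_{i+1} ≤ Σ_k x_k y_k`** for the increasing zeros of two positive recurrences of the same size. [Hoffman–Wielandt
1953; Wilkinson Ch. 2 §48; this file, §1182] -/
theorem trace_symmJacobi_mul_le {q q' : ℕ → ℝ[X]} {a a' b b' : ℕ → ℝ} (hq0 : q 0 = 1) (hq1 : q 1 = Polynomial.X - C (a 0))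
    (hrec : ∀ n, q (n + 2) = (Polynomial.X - C (a (n + 1))) * q (n + 1) - C (b (n + 1)) * q n) (hq0' : q' 0 = 1) (hq1' : q' 1 = Polynomial.X - C (a' 0))
    (hrec' : ∀ n, q' (n + 2) = (Polynomial.X - C (a' (n + 1))) * q' (n + 1) - C (b' (n + 1)) * q' n) (hb : ∀ j, 0 < b j) (hb' : ∀ j, 0 < b' j) {t : ℕ}
    {x y : Fin (t + 1) → ℝ} (hx : StrictMono x) (hxq : q (t + 1) = ∏ k, (Polynomial.X - C (x k))) (hy : StrictMono y) (hyq : q' (t + 1) = ∏ k, (Polynomial.X - C (y k))) :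
    ∑ i ∈ Finset.range (t + 1), a i * a' i + 2 * ∑ i ∈ Finset.range t, Real.sqrt (b (i + 1)) * Real.sqrt (b' (i + 1)) ≤ ∑ k, x k * y k := by
  set Js : Matrix (Fin (t + 1)) (Fin (t + 1)) ℝ := Matrix.of fun i j : Fin (t + 1) =>
    if (i : ℕ) = j then a i else if (j : ℕ) = i + 1 then Real.sqrt (b j) else if (i : ℕ) = j + 1 then Real.sqrt (b i) else 0 with hJsdef
  set Js' : Matrix (Fin (t + 1)) (Fin (t + 1)) ℝ := Matrix.of fun i j : Fin (t + 1) =>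
    if (i : ℕ) = j then a' i else if (j : ℕ) = i + 1 then Real.sqrt (b' j) else if (i : ℕ) = j + 1 then Real.sqrt (b' i) else 0 with hJs'def
  have hJs : ∀ i j : Fin (t + 1), Js i j = if (i : ℕ) = j then a i else if (j : ℕ) = i + 1 then Real.sqrt (b j) else if (i : ℕ) = j + 1 then Real.sqrt (b i) else 0 :=
    fun i j => by rw [hJsdef, Matrix.of_apply]
  have hJs' : ∀ i j : Fin (t + 1), Js' i j = if (i : ℕ) = j then a' i else if (j : ℕ) = i + 1 then Real.sqrt (b' j) else if (i : ℕ) = j + 1 then Real.sqrt (b' i) else 0 :=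
    fun i j => by rw [hJs'def, Matrix.of_apply]
  obtain ⟨Q, hQ1, hQ2, hQe⟩ := symmJacobi_orthogonal_eigen hq0 hq1 hrec hb hJs hx hxq
  obtain ⟨Q', hQ1', hQ2', hQe'⟩ := symmJacobi_orthogonal_eigen hq0' hq1' hrec' hb' hJs' hy hyq
  rw [← trace_symmJacobi_mul hJs hJs', trace_symmJacobi_mul_eq_sum_sq hQ1 hQe hQ1' hQe']
  refine sum_sq_mul_mul_le_of_orthogonal hx.monotone hy.monotone ?_ ?_
  · rw [Matrix.transpose_mul, Matrix.transpose_transpose, Matrix.mul_assoc, ← Matrix.mul_assoc Q', hQ1', Matrix.one_mul, hQ2]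
  · rw [Matrix.transpose_mul, Matrix.transpose_transpose, Matrix.mul_assoc, ← Matrix.mul_assoc Q, hQ1, Matrix.one_mul, hQ2']

/-- **`Σ_k x_k² = Σ_{i≤t} a_i² + 2 Σ_{i<t} b_{i+1}`** (`= tr((J^s)²)`; every `t`, re-derived from the orthogonal diagonalisation). [Chihara I (4.14); this file, §1182] -/
theorem zeros_sq_sum_eq_trace {q : ℕ → ℝ[X]} {a b : ℕ → ℝ} (hq0 : q 0 = 1) (hq1 : q 1 = Polynomial.X - C (a 0))
    (hrec : ∀ n, q (n + 2) = (Polynomial.X - C (a (n + 1))) * q (n + 1) - C (b (n + 1)) * q n) (hb : ∀ j, 0 < b j) {t : ℕ}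
    {x : Fin (t + 1) → ℝ} (hx : StrictMono x) (hxq : q (t + 1) = ∏ k, (Polynomial.X - C (x k))) :
    ∑ k, x k ^ 2 = ∑ i ∈ Finset.range (t + 1), a i ^ 2 + 2 * ∑ i ∈ Finset.range t, b (i + 1) := by
  set Js : Matrix (Fin (t + 1)) (Fin (t + 1)) ℝ := Matrix.of fun i j : Fin (t + 1) =>
    if (i : ℕ) = j then a i else if (j : ℕ) = i + 1 then Real.sqrt (b j) else if (i : ℕ) = j + 1 then Real.sqrt (b i) else 0 with hJsdef
  have hJs : ∀ i j : Fin (t + 1), Js i j = if (i : ℕ) = j then a i else if (j : ℕ) = i + 1 then Real.sqrt (b j) else if (i : ℕ) = j + 1 then Real.sqrt (b i) else 0 :=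
    fun i j => by rw [hJsdef, Matrix.of_apply]
  obtain ⟨Q, hQ1, hQ2, hQe⟩ := symmJacobi_orthogonal_eigen hq0 hq1 hrec hb hJs hx hxq
  have h1 := trace_symmJacobi_mul_eq_sum_sq hQ1 hQe hQ1 hQe
  rw [trace_symmJacobi_mul hJs hJs, hQ2] at h1
  rw [Finset.sum_congr rfl fun i _ => show a i ^ 2 = a i * a i by ring, Finset.sum_congr rfl fun i _ => (Real.mul_self_sqrt (hb (i + 1)).le).symm, h1]
  refine Finset.sum_congr rfl fun k _ => ?_
  rw [Finset.sum_eq_single k (fun l _ hl => by rw [Matrix.one_apply_ne (Ne.symm hl)]; ring) (fun h => absurd (Finset.mem_univ k) h), Matrix.one_apply_eq]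
  ring

/-- **HOFFMAN–WIELANDT FOR JACOBI MATRICES: `Σ_k (y_k − x_k)² ≤ Σ_{i≤t} (a'_i − a_i)² + 2 Σ_{i<t} (√b'_{i+1} − √b_{i+1})²`** — the increasingly ordered Gauss nodes of two positive recurrences
of the same size are `ℓ²`-close when the symmetric Jacobi matrices are Frobenius-close. [Hoffman–Wielandt 1953 Thm 1; Bhatia Thm VI.4.1; Wilkinson Ch. 2 §48; this file, §1182] -/
theorem hoffman_wielandt_recurrence {q q' : ℕ → ℝ[X]} {a a' b b' : ℕ → ℝ} (hq0 : q 0 = 1) (hq1 : q 1 = Polynomial.X - C (a 0))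
    (hrec : ∀ n, q (n + 2) = (Polynomial.X - C (a (n + 1))) * q (n + 1) - C (b (n + 1)) * q n) (hq0' : q' 0 = 1) (hq1' : q' 1 = Polynomial.X - C (a' 0))
    (hrec' : ∀ n, q' (n + 2) = (Polynomial.X - C (a' (n + 1))) * q' (n + 1) - C (b' (n + 1)) * q' n) (hb : ∀ j, 0 < b j) (hb' : ∀ j, 0 < b' j) {t : ℕ}
    {x y : Fin (t + 1) → ℝ} (hx : StrictMono x) (hxq : q (t + 1) = ∏ k, (Polynomial.X - C (x k))) (hy : StrictMono y) (hyq : q' (t + 1) = ∏ k, (Polynomial.X - C (y k))) :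
    ∑ k, (y k - x k) ^ 2 ≤ ∑ i ∈ Finset.range (t + 1), (a' i - a i) ^ 2 + 2 * ∑ i ∈ Finset.range t, (Real.sqrt (b' (i + 1)) - Real.sqrt (b (i + 1))) ^ 2 := by
  have hmix := trace_symmJacobi_mul_le hq0 hq1 hrec hq0' hq1' hrec' hb hb' hx hxq hy hyq
  have hxx := zeros_sq_sum_eq_trace hq0 hq1 hrec hb hx hxq
  have hyy := zeros_sq_sum_eq_trace hq0' hq1' hrec' hb' hy hyq
  have e1 : ∑ k, (y k - x k) ^ 2 = ∑ k, y k ^ 2 + ∑ k, x k ^ 2 - 2 * ∑ k, x k * y k := by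
    rw [← Finset.sum_add_distrib, Finset.mul_sum, ← Finset.sum_sub_distrib]; exact Finset.sum_congr rfl fun k _ => by ring
  have e2 : ∑ i ∈ Finset.range (t + 1), (a' i - a i) ^ 2 = ∑ i ∈ Finset.range (t + 1), a' i ^ 2 + ∑ i ∈ Finset.range (t + 1), a i ^ 2 - 2 * ∑ i ∈ Finset.range (t + 1), a i * a' i := by
    rw [← Finset.sum_add_distrib, Finset.mul_sum, ← Finset.sum_sub_distrib]; exact Finset.sum_congr rfl fun i _ => by ring
  have e3 : ∑ i ∈ Finset.range t, (Real.sqrt (b' (i + 1)) - Real.sqrt (b (i + 1))) ^ 2 =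
      ∑ i ∈ Finset.range t, b' (i + 1) + ∑ i ∈ Finset.range t, b (i + 1) - 2 * ∑ i ∈ Finset.range t, Real.sqrt (b (i + 1)) * Real.sqrt (b' (i + 1)) := by
    rw [← Finset.sum_add_distrib, Finset.mul_sum, ← Finset.sum_sub_distrib]
    exact Finset.sum_congr rfl fun i _ => by
      have h1 := Real.sq_sqrt (hb (i + 1)).le
      have h2 := Real.sq_sqrt (hb' (i + 1)).le
      nlinarith [h1, h2]
  rw [e1, e2, e3, hxx, hyy]
  linarith

end Summit.Ventures.HSemireg.Wedge.HankelOuter
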